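import Literature.AnabelianGeometry.EtaleTheta.Discharge.Sec2Prop214iiiInversionOfModel

/-!
# [EtTh] Prop 2.14 (iii), existence half per automorphism, in the `RigidData.Induces` currency of the
# typed statement `Prop214_iii_mono` (proof-only companion)

Mochizuki, *The Étale Theta Function and its Frobenioid-theoretic Manifestations* [EtTh], Publ. RIMS 45
(2009), §2, Prop 2.14 (iii) pp.49–50 (locators `p.N` = PDF pages; bib key `MochizukiEtTh2009`).
PROOF-ONLY companion (no `def`; seat abc-iut-L2-t2, §2 owner) of `ThetaRigidity.lean`: the typed
`RigidData.Prop214_iii_mono` quantifies, for `(s, ε) ∈ (l·ℤ) ⋊ {±1}`, over pairs `(α, a)` with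
`R.Induces α a` (`a : Π^tp_Y ≃ₜ* Π^tp_Y` the automorphism induced by `α ∈ Aut(M)`, Prop 2.11 (ii)) and
`R.ActsOnCuspsBy a s ε`. `Discharge/Sec2MonoThetaAutLift.lean` / `…InversionOfModel.lean` produce `α` with
the `Π^tp_Y`-component of `α` equal to `φ` pointwise; here that is repackaged as `∃ a, R.Induces α a ∧
a = φ|_{Π^tp_Y}` (the pattern of abc-iut-L2-t2 g3's `RigidData.exists_induces_of_right_eq` for the
translations, `Discharge/Sec2Prop214iiiMonoInduces.lean`):

* `RigidData.exists_induces_of_right_eq_aut` — an automorphism of `Π^tp_Y[μ_N]` whose `Π^tp_Y`-component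
  is `φ ∈ Aut_top(Π^tp_X)` (`φ(Π^tp_Y) = Π^tp_Y`) INDUCES the bi-continuous restriction `φ|_{Π^tp_Y}`;
* `RigidData.exists_monoIso_induces_over_aut_of_cor218_ii` (+ `_of_comp_symm_mem`) — Prop 2.14 (iii)
  existence half per automorphism, `Induces` form;
* `DoubleUnderline.rigidData_exists_monoIso_induces_over_inversion_tower` — the `{±1}`-part AT THE §1
  MODEL in `Induces` form: given the inversion datum of `…InversionOfModel.lean` (and Prop 1.5 (ii),
  (iii) through abc-iut-L2-t10's `rigidData_cor218_ii`), for every theta cocycle `η` there are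
  `α ∈ Aut(M(η))` and `a = ι|_{Π^tp_Y̲̲}` with `R.Induces α a`. What then remains of the typed clause
  `∃ α a, R.Induces α a ∧ R.ActsOnCuspsBy a s (-1)` is EXACTLY the label bookkeeping
  `R.ActsOnCuspsBy a s (-1)` ("relative to the labels `∈ ℤ` on these cusps … an automorphism
  `∈ (l·ℤ) ⋊ {±1}`", p.49) — interface input at the model (`C.CuspLabels` carries no equivariance).

HONEST FRAMING: [EtTh] is refereed; OUR kernel checks over the typed §2 interface and the cell's §1 model;
no side is taken on [IUTchIII] Cor 3.12; typed ≠ discharged elsewhere.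
-/

noncomputable section

namespace Literature.AnabelianGeometry.EtaleTheta

universe u

namespace RigidData

variable {N : ℕ+} {l : ℕ} (R : RigidData.{u} N l)

/-- **An automorphism of `Π^tp_Y[μ_N]` with `Π^tp_Y`-component `φ` induces `φ|_{Π^tp_Y}`** (`RigidData.Induces`),
the restriction being a bi-continuous automorphism of `Π^tp_Y` (`φ(Π^tp_Y) = Π^tp_Y`).
[cite: MochizukiEtTh2009, Prop 2.14(iii) p.49] -/
theorem exists_induces_of_right_eq_aut (φ : R.PiX ≃ₜ* R.PiX)
    (hY : R.PiY.map φ.toMulEquiv.toMonoidHom = R.PiY) (α : MulAut R.env)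
    (hα : ∀ z : R.env, (((α z).right : R.PiY) : R.PiX) = φ ((z.right : R.PiY) : R.PiX)) :
    ∃ a : R.PiY ≃ₜ* R.PiY, R.Induces α a ∧ ∀ y : R.PiY, ((a y : R.PiY) : R.PiX) = φ (y : R.PiX) := by
  let a : R.PiY ≃ₜ* R.PiY :=
    { toMulEquiv := (φ.toMulEquiv.subgroupMap R.PiY).trans (MulEquiv.subgroupCongr hY)
      continuous_toFun := continuous_induced_rng.2 (by exact φ.continuous.comp continuous_subtype_val)
      continuous_invFun :=
        continuous_induced_rng.2 (by exact φ.symm.continuous.comp continuous_subtype_val) }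
  exact ⟨a, fun z => Subtype.ext (hα z), fun y => rfl⟩

/-- **Prop 2.14 (iii) existence half, per automorphism, `Induces` form (Cor 2.18 (ii) BY NAME)**: under the
hypotheses of `exists_monoIso_over_aut_of_cor218_ii`, there are `α ∈ Aut(M(η))` and `a = φ|_{Π^tp_Y}` with
`R.Induces α a`. [cite: MochizukiEtTh2009, Prop 2.14(iii) p.50] -/
theorem exists_monoIso_induces_over_aut_of_cor218_ii (h218ii : R.Cor218_ii)
    {η : R.PiYdd → R.mu} (hη : η ∈ R.thetaCocycles)
    (φ : R.PiX ≃ₜ* R.PiX) (hY : R.PiY.map φ.toMulEquiv.toMonoidHom = R.PiY)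
    (hdd : R.PiYdd.map φ.toMulEquiv.toMonoidHom = R.PiYdd)
    (hker : R.aug.ker.map φ.toMulEquiv.toMonoidHom = R.aug.ker)
    (hK : R.thetaKer.map φ.toMulEquiv.toMonoidHom = R.thetaKer)
    (hL : R.lDeltaTheta.map φ.toMulEquiv.toMonoidHom = R.lDeltaTheta)
    (ψ : R.mu ≃* R.mu) {η'' : R.PiYdd → R.mu} (hη'' : η'' ∈ R.thetaCocycles)
    (c : R.G → R.mu) (hc : CycEnvelope.IsEnvCocycle R.augY R.chi (c ∘ R.augY))
    (hcc : CycEnvelope.shift hc ∈ contMulAut R.env)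
    (hηc : ∀ d d' : R.PiYdd, φ (d : R.PiX) = d' → ψ (η d) = η'' d' * c (R.augY (R.inclYdd d'))) :
    ∃ (α : (R.modelMono hη).Iso (R.modelMono hη)) (a : R.PiY ≃ₜ* R.PiY),
      R.Induces α.e.toMulEquiv a ∧ ∀ y : R.PiY, ((a y : R.PiY) : R.PiX) = φ (y : R.PiX) := by
  obtain ⟨α, hα⟩ := R.exists_monoIso_over_aut_of_cor218_ii h218ii hη φ hY hdd hker hK hL ψ hη'' c hc hcc hηc
  obtain ⟨a, ha, ha'⟩ := R.exists_induces_of_right_eq_aut φ hY α.e.toMulEquiv hα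
  exact ⟨α, a, ha, ha'⟩

/-- **The untwisted case, `Induces` form**: `η ∘ φ⁻¹ ∈` the collection and Cor 2.18 (ii) BY NAME give
`α ∈ Aut(M(η))` inducing `φ|_{Π^tp_Y}` — the `{±1}`-shape of Prop 2.14 (iii).
[cite: MochizukiEtTh2009, Prop 2.14(iii) p.50] -/
theorem exists_monoIso_induces_over_aut_of_comp_symm_mem (h218ii : R.Cor218_ii)
    {η : R.PiYdd → R.mu} (hη : η ∈ R.thetaCocycles)
    (φ : R.PiX ≃ₜ* R.PiX) (hY : R.PiY.map φ.toMulEquiv.toMonoidHom = R.PiY)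
    (hdd : R.PiYdd.map φ.toMulEquiv.toMonoidHom = R.PiYdd)
    (hker : R.aug.ker.map φ.toMulEquiv.toMonoidHom = R.aug.ker)
    (hK : R.thetaKer.map φ.toMulEquiv.toMonoidHom = R.thetaKer)
    (hL : R.lDeltaTheta.map φ.toMulEquiv.toMonoidHom = R.lDeltaTheta)
    (hmem : (fun d : R.PiYdd => η ⟨φ.symm (d : R.PiX),
      (R.toThetaEnvData.mem_and_symm_mem_of_map_eq φ _ hdd).2 _ d.2⟩) ∈ R.thetaCocycles) :
    ∃ (α : (R.modelMono hη).Iso (R.modelMono hη)) (a : R.PiY ≃ₜ* R.PiY),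
      R.Induces α.e.toMulEquiv a ∧ ∀ y : R.PiY, ((a y : R.PiY) : R.PiX) = φ (y : R.PiX) := by
  obtain ⟨α, hα⟩ := R.exists_monoIso_over_aut_of_comp_symm_mem h218ii hη φ hY hdd hker hK hL hmem
  obtain ⟨a, ha, ha'⟩ := R.exists_induces_of_right_eq_aut φ hY α.e.toMulEquiv hα
  exact ⟨α, a, ha, ha'⟩

end RigidData

/-! ## At the §1 model -/

namespace ThetaSetting.EtaleThetaData.DoubleUnderline

variable {p : ℕ} [Fact p.Prime] {D : ThetaSetting p} {E : D.EtaleThetaData} {l : ℕ}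
  (C : E.DoubleUnderline l) (ι : D.PiTemp ≃ₜ* D.PiTemp)

/-- **[EtTh] Prop 2.14 (iii), `{±1}`-part AT THE §1 MODEL, `Induces` form (Cor 2.18 (ii) BY NAME)**:
for `R = C.rigidData μ hC hS h15 L` and the inversion datum of `Sec2Prop214iiiInversionOfModel.lean`, every
theta cocycle `η` admits `α ∈ Aut(M(η))` and `a : Π^tp_Y̲̲ ≃ₜ* Π^tp_Y̲̲` with `R.Induces α a` and `a = ι` on
`Π^tp_Y̲̲`. The typed clause of `Prop214_iii_mono` at `ε = −1` then reduces to the LABEL clause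
`R.ActsOnCuspsBy a s (-1)` (interface input). [cite: MochizukiEtTh2009, Prop 2.14(iii) p.50] -/
theorem rigidData_exists_monoIso_induces_over_inversion {N : ℕ+} (μ : D.CyclotomeMod l N)
    (c : ThetaCompanion ι) (h : Thm16i ι) (hι : C.Huu.map ι.toMulEquiv.toMonoidHom = C.Huu)
    (φ : ↥C.Huu ≃ₜ* ↥C.Huu) (hφ : ∀ x : C.Huu, ((φ x : C.Huu) : D.PiTemp) = ι x)
    (hC : D.Compat) (hS : D.Sec2Hyps) (h15 : Prop15iii E hC) (L : C.CuspLabels)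
    (h218ii : (C.rigidData μ hC hS h15 L).Cor218_ii)
    (hιY : ∀ x : D.PiTemp, x ∈ D.GtpY ↔ ι x ∈ D.GtpY)
    (hιΔ : ∀ x : D.PiTemp, D.aug x = 1 ↔ D.aug (ι x) = 1)
    (hβ : ∀ a ∈ D.DeltaTheta, c.thetaIso a = a)
    (hιη : haveI := hC.GtpYdd_normal
      ∃ τ ∈ C.Huu, transport c h E.etaDd = ContH1.conj D.toTheta D.DeltaTheta τ E.etaDd)
    {η : D.GtpYdd.subgroupOf C.Huu → MuN p N} (hη : η ∈ C.thetaCocycles hC μ) :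
    ∃ (α : ((C.rigidData μ hC hS h15 L).modelMono hη).Iso ((C.rigidData μ hC hS h15 L).modelMono hη))
      (a : (C.rigidData μ hC hS h15 L).PiY ≃ₜ* (C.rigidData μ hC hS h15 L).PiY),
      (C.rigidData μ hC hS h15 L).Induces α.e.toMulEquiv a ∧
        ∀ y : (C.rigidData μ hC hS h15 L).PiY,
          (((a y : (C.rigidData μ hC hS h15 L).PiY) : C.Huu) : D.PiTemp) = ι ((y : C.Huu) : D.PiTemp) := by
  obtain ⟨α, hα⟩ := C.rigidData_exists_monoIso_over_inversion μ ι c h hι φ hφ hC hS h15 L h218ii hιY hιΔ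
    hβ hιη hη
  have hY' : (C.rigidData μ hC hS h15 L).PiY.map φ.toMulEquiv.toMonoidHom = (C.rigidData μ hC hS h15 L).PiY :=
    C.map_eq_of_invariant ι φ hφ (· ∈ D.GtpY) hιY _ fun x => Subgroup.mem_subgroupOf
  have hα' : ∀ z : (C.rigidData μ hC hS h15 L).env,
      (((α.e.toMulEquiv z).right : (C.rigidData μ hC hS h15 L).PiY) : C.Huu) =
        φ ((z.right : (C.rigidData μ hC hS h15 L).PiY) : C.Huu) := fun z =>
    Subtype.ext (by rw [hφ]; exact hα z)
  obtain ⟨a, ha, ha'⟩ :=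
    (C.rigidData μ hC hS h15 L).exists_induces_of_right_eq_aut φ hY' α.e.toMulEquiv hα'
  exact ⟨α, a, ha, fun y => by rw [ha', hφ]⟩

/-- **The same at every level of a `CyclotomeTower`**, Cor 2.18 (ii) supplied by abc-iut-L2-t10's
`rigidData_cor218_ii` (conditional on Prop 1.5 (ii), (iii) and the inversion datum only).
[cite: MochizukiEtTh2009, Prop 2.14(iii) p.50] -/
theorem rigidData_exists_monoIso_induces_over_inversion_tower {Es : Set ℕ+} (τ : D.CyclotomeTower l Es)
    (M : Es) (c : ThetaCompanion ι) (h : Thm16i ι) (hι : C.Huu.map ι.toMulEquiv.toMonoidHom = C.Huu)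
    (φ : ↥C.Huu ≃ₜ* ↥C.Huu) (hφ : ∀ x : C.Huu, ((φ x : C.Huu) : D.PiTemp) = ι x)
    (hC : D.Compat) (hS : D.Sec2Hyps) (h15 : Prop15iii E hC) (h15ii : Prop15ii E.toKummerData hC)
    (L : C.CuspLabels)
    (hιY : ∀ x : D.PiTemp, x ∈ D.GtpY ↔ ι x ∈ D.GtpY)
    (hιΔ : ∀ x : D.PiTemp, D.aug x = 1 ↔ D.aug (ι x) = 1)
    (hβ : ∀ a ∈ D.DeltaTheta, c.thetaIso a = a)
    (hιη : haveI := hC.GtpYdd_normal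
      ∃ τ ∈ C.Huu, transport c h E.etaDd = ContH1.conj D.toTheta D.DeltaTheta τ E.etaDd)
    {η : D.GtpYdd.subgroupOf C.Huu → MuN p M} (hη : η ∈ C.thetaCocycles hC (τ.mod M)) :
    ∃ (α : ((C.rigidData (τ.mod M) hC hS h15 L).modelMono hη).Iso
        ((C.rigidData (τ.mod M) hC hS h15 L).modelMono hη))
      (a : (C.rigidData (τ.mod M) hC hS h15 L).PiY ≃ₜ* (C.rigidData (τ.mod M) hC hS h15 L).PiY),
      (C.rigidData (τ.mod M) hC hS h15 L).Induces α.e.toMulEquiv a ∧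
        ∀ y : (C.rigidData (τ.mod M) hC hS h15 L).PiY,
          (((a y : (C.rigidData (τ.mod M) hC hS h15 L).PiY) : C.Huu) : D.PiTemp) =
            ι ((y : C.Huu) : D.PiTemp) :=
  C.rigidData_exists_monoIso_induces_over_inversion ι (τ.mod M) c h hι φ hφ hC hS h15 L
    (C.rigidData_cor218_ii τ M hC hS h15 h15ii L) hιY hιΔ hβ hιη hη

end ThetaSetting.EtaleThetaData.DoubleUnderline

end Literature.AnabelianGeometry.EtaleTheta

end
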